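import Summits.CriticalPhenomena.CardyFormulaZ2.Theorems.CardyBoundaryCoulombGasBoundaryDefectGaussianRStubTransportPathsPart12
import Summits.CriticalPhenomena.CardyFormulaZ2.Theorems.CardyBoundaryCoulombGasBoundaryDefectGaussianRStubTransportPathsPart13

/-!
# Stub `stub_transportPaths` of line `rainbow-monomials-in-excursion-kernels` — Part 16:
# rail points of the lattice approximation (flatness and walk facts at a mover's position)
# (crux `CardyBoundaryCoulombGas.BoundaryDefectGaussianR`, stmt-CriticalPhenomena-14132)

For the edge `z` of the polygon (frame exponent `e = a z`, `K = e` as an element of `Fin 4`,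
corner `P = γ (c z)`, along-coordinate `A = re (P (-i)^e)`, offset `B = im (P (-i)^e)`), the
RAIL of the lattice approximation `V = {v : δ v ∈ closure D}` is the lattice line
`⟨v, dir (K+1)⟩ = ⌈B/δ⌉`, and its point of along-coordinate `x` is
`R = x • dir K + ⌈B/δ⌉ • dir (K+1)`. `tp_rail_point`: if the foot `q = P + (δ x - A) i^e` of `R`
is at distance `≥ λ = δ (R' + 1)` (`R' ≥ 3`, `λ ≤ κ₀`) from both corners of the edge, then
(uniform flat chart of Part 12 read on the lattice, Part 13) `R` satisfies the flatness clause of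
TRANSPORT with radius `R'` and inward normal `dir (K+1)`, lies in `V` with exactly one outside
neighbour, `outDart V R = (R, K+3)`, and the boundary walk steps `R - dir K ↦ R ↦ R + dir K`.
Also: `tp_natCast_fin4` (casting exponents to `Fin 4`). All [folklore].
-/

noncomputable section

open Set Filter Metric Topology
open Literature.Probability.RandomPlanarGeometry
open Literature.Probability.LatticeModels Literature.Probability.LatticeModels.CollarLegModel
open Summit.CriticalPhenomena.CardyFormulaZ2.Cruxes.RectilinearCardy.ExcursionKernelCovariance

namespace Summit.CriticalPhenomena.CardyFormulaZ2.Cruxes.BoundaryDefectGaussianR.RainbowMonomialsInExcursionKernels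

/-- Casting a small exponent to `Fin 4` and back. [folklore] -/
theorem tp_natCast_fin4 {e : ℕ} (he : e < 4) : ((Fin.ofNat 4 e : Fin 4) : ℕ) = e := by
  rw [Fin.val_ofNat, Nat.mod_eq_of_lt he]

/-- The rail point `x • dir K + Y • dir (K+1)` has coordinates `x` along `dir K` and `Y` along
`dir (K+1)`. [folklore] -/
theorem tp_rail_coords (K : Fin 4) (x Y : ℤ) :
    ((x • dir K + Y • dir (K + 1)).1 * (dir K).1 + (x • dir K + Y • dir (K + 1)).2 * (dir K).2 = x) ∧
    ((x • dir K + Y • dir (K + 1)).1 * (dir (K + 1)).1 +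
      (x • dir K + Y • dir (K + 1)).2 * (dir (K + 1)).2 = Y) := by
  fin_cases K <;> simp [tp_dir_val]

/-- Linearity of the frame coordinates and the lattice norm of a frame displacement:
for `X = C + s • dir K + t • dir (K+1)`, `⟨X, dir K⟩ = ⟨C, dir K⟩ + s`,
`⟨X, dir (K+1)⟩ = ⟨C, dir (K+1)⟩ + t`, `|X - C|² = s² + t²`. [folklore] -/
theorem tp_dot_lin (K : Fin 4) (C : ℤ × ℤ) (s t : ℤ) :
    ((C + s • dir K + t • dir (K + 1)).1 * (dir K).1 + (C + s • dir K + t • dir (K + 1)).2 * (dir K).2 =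
      C.1 * (dir K).1 + C.2 * (dir K).2 + s) ∧
    ((C + s • dir K + t • dir (K + 1)).1 * (dir (K + 1)).1 +
        (C + s • dir K + t • dir (K + 1)).2 * (dir (K + 1)).2 =
      C.1 * (dir (K + 1)).1 + C.2 * (dir (K + 1)).2 + t) ∧
    ((C + s • dir K + t • dir (K + 1)).1 - C.1) ^ 2 + ((C + s • dir K + t • dir (K + 1)).2 - C.2) ^ 2 =
      s ^ 2 + t ^ 2 := by
  obtain ⟨x, y⟩ := C
  fin_cases K <;> simp [tp_dir_val] <;> refine ⟨?_, ?_⟩ <;> ring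

/-- **A rail point.** See the module docstring. [folklore] -/
theorem tp_rail_point (D : JordanDomain) {M : ℕ} {c : ℤ → ℝ} {a τ : ℤ → ℕ}
    (hM2 : 2 ≤ M) (hcmono : StrictMono c) (hcper : ∀ z, c (z + M) = c z + 1)
    (ha4 : ∀ z, a z < 4) (hτ : ∀ z, τ z = 1 ∨ τ z = 3)
    (hmodτ : ∀ z, (a z + τ z) % 4 = (a (z - 1) + 2) % 4)
    (hdir : ∀ z, ∀ t ∈ Icc (c z) (c (z + 1)), D.boundary t =
      D.boundary (c z) + ((‖D.boundary t - D.boundary (c z)‖ : ℝ) : ℂ) * Complex.I ^ (a z))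
    (hmono : ∀ z, StrictMonoOn (fun t => ‖D.boundary t - D.boundary (c z)‖) (Icc (c z) (c (z + 1))))
    (hflatch : ∀ z, ∀ t ∈ Ioo (c z) (c (z + 1)), ∃ r : ℝ, 0 < r ∧ (∀ w, dist w (D.boundary t) < r
      → (w ∈ frontier D.carrier ↔ (((w - D.boundary t) * (-Complex.I) ^ a z).im = 0 ∧ 0 ≤ ((w -
      D.boundary t) * (-Complex.I) ^ a z).re) ∨ (((w - D.boundary t) * (-Complex.I) ^ (a z +
      2)).im = 0 ∧ 0 ≤ ((w - D.boundary t) * (-Complex.I) ^ (a z + 2)).re))) ∧ (∀ w, dist w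
      (D.boundary t) < r → (w ∈ D.carrier ↔ ((2 = 1 → 0 < ((w - D.boundary t) * (-Complex.I) ^ a
      z).re ∧ 0 < ((w - D.boundary t) * (-Complex.I) ^ a z).im) ∧ (2 = 2 → 0 < ((w - D.boundary t)
      * (-Complex.I) ^ a z).im) ∧ (2 = 3 → 0 < ((w - D.boundary t) * (-Complex.I) ^ a z).im ∨ ((w
      - D.boundary t) * (-Complex.I) ^ a z).re < 0)))) ∧ (∀ w, dist w (D.boundary t) < r → (w ∈
      closure D.carrier ↔ ((2 = 1 → 0 ≤ ((w - D.boundary t) * (-Complex.I) ^ a z).re ∧ 0 ≤ ((w -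
      D.boundary t) * (-Complex.I) ^ a z).im) ∧ (2 = 2 → 0 ≤ ((w - D.boundary t) * (-Complex.I) ^
      a z).im) ∧ (2 = 3 → 0 ≤ ((w - D.boundary t) * (-Complex.I) ^ a z).im ∨ ((w - D.boundary t) *
      (-Complex.I) ^ a z).re ≤ 0)))))
    {κ₀ : ℝ} (hκ₀ : ∀ z z' : ℤ, z + 2 ≤ z' → z' ≤ z + M - 2 →
      ∀ t ∈ Icc (c z) (c (z + 1)), ∀ t' ∈ Icc (c z') (c (z' + 1)),
        κ₀ ≤ dist (D.boundary t) (D.boundary t'))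
    {δ : ℝ} (hδ : 0 < δ) {V : Finset (ℤ × ℤ)}
    (hV : ∀ v : ℤ × ℤ, v ∈ V ↔
      ((v.1 : ℂ) * ((δ : ℝ) : ℂ) + (v.2 : ℂ) * ((δ : ℝ) : ℂ) * Complex.I) ∈ closure D.carrier)
    (z x : ℤ) (R' : ℕ) (hR' : 3 ≤ R') (hκ : δ * (R' + 1) ≤ κ₀)
    (h1 : δ * (R' + 1) ≤ δ * x - (D.boundary (c z) * (-Complex.I) ^ (a z)).re)
    (h2 : δ * x - (D.boundary (c z) * (-Complex.I) ^ (a z)).re ≤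
      ‖D.boundary (c (z + 1)) - D.boundary (c z)‖ - δ * (R' + 1)) :
    (∀ v : ℤ × ℤ, (((v.1 - ((x • dir (Fin.ofNat 4 (a z)) +
        ⌈(D.boundary (c z) * (-Complex.I) ^ (a z)).im / δ⌉ • dir ((Fin.ofNat 4 (a z)) + 1))).1) ^ 2 +
        (v.2 - ((x • dir (Fin.ofNat 4 (a z)) +
        ⌈(D.boundary (c z) * (-Complex.I) ^ (a z)).im / δ⌉ • dir ((Fin.ofNat 4 (a z)) + 1))).2) ^ 2 :
          ℤ) : ℝ) ≤ (R' : ℝ) ^ 2 →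
      (v ∈ V ↔ 0 ≤ (v.1 - (x • dir (Fin.ofNat 4 (a z)) +
        ⌈(D.boundary (c z) * (-Complex.I) ^ (a z)).im / δ⌉ • dir ((Fin.ofNat 4 (a z)) + 1)).1) *
          (dir ((Fin.ofNat 4 (a z)) + 1)).1 +
        (v.2 - (x • dir (Fin.ofNat 4 (a z)) +
        ⌈(D.boundary (c z) * (-Complex.I) ^ (a z)).im / δ⌉ • dir ((Fin.ofNat 4 (a z)) + 1)).2) *
          (dir ((Fin.ofNat 4 (a z)) + 1)).2)) ∧
    ((x • dir (Fin.ofNat 4 (a z)) +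
        ⌈(D.boundary (c z) * (-Complex.I) ^ (a z)).im / δ⌉ • dir ((Fin.ofNat 4 (a z)) + 1)) ∈ V ∧
      (x • dir (Fin.ofNat 4 (a z)) +
        ⌈(D.boundary (c z) * (-Complex.I) ^ (a z)).im / δ⌉ • dir ((Fin.ofNat 4 (a z)) + 1)) +
          dir ((Fin.ofNat 4 (a z)) + 3) ∉ V ∧
      ((neighbours (x • dir (Fin.ofNat 4 (a z)) +
        ⌈(D.boundary (c z) * (-Complex.I) ^ (a z)).im / δ⌉ • dir ((Fin.ofNat 4 (a z)) + 1))).filter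
          (fun y => y ∉ V)).card = 1 ∧
      outDart V (x • dir (Fin.ofNat 4 (a z)) +
        ⌈(D.boundary (c z) * (-Complex.I) ^ (a z)).im / δ⌉ • dir ((Fin.ofNat 4 (a z)) + 1)) =
        some (x • dir (Fin.ofNat 4 (a z)) +
          ⌈(D.boundary (c z) * (-Complex.I) ^ (a z)).im / δ⌉ • dir ((Fin.ofNat 4 (a z)) + 1),
          (Fin.ofNat 4 (a z)) + 3) ∧
      dsucc V (x • dir (Fin.ofNat 4 (a z)) +
        ⌈(D.boundary (c z) * (-Complex.I) ^ (a z)).im / δ⌉ • dir ((Fin.ofNat 4 (a z)) + 1),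
          (Fin.ofNat 4 (a z)) + 3) =
        (x • dir (Fin.ofNat 4 (a z)) +
          ⌈(D.boundary (c z) * (-Complex.I) ^ (a z)).im / δ⌉ • dir ((Fin.ofNat 4 (a z)) + 1) +
          dir (Fin.ofNat 4 (a z)), (Fin.ofNat 4 (a z)) + 3) ∧
      dsucc V (x • dir (Fin.ofNat 4 (a z)) +
        ⌈(D.boundary (c z) * (-Complex.I) ^ (a z)).im / δ⌉ • dir ((Fin.ofNat 4 (a z)) + 1) -
          dir (Fin.ofNat 4 (a z)), (Fin.ofNat 4 (a z)) + 3) =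
        (x • dir (Fin.ofNat 4 (a z)) +
          ⌈(D.boundary (c z) * (-Complex.I) ^ (a z)).im / δ⌉ • dir ((Fin.ofNat 4 (a z)) + 1),
          (Fin.ofNat 4 (a z)) + 3)) := by
  set γ := D.boundary with hγ
  have hγc : Continuous γ := D.continuous_boundary
  set e := a z with he
  set K : Fin 4 := Fin.ofNat 4 e with hK
  have hKe : (K : ℕ) = e := tp_natCast_fin4 (ha4 z)
  set P := γ (c z) with hP
  set A := (P * (-Complex.I) ^ e).re with hA
  set B := (P * (-Complex.I) ^ e).im with hB
  set Y := ⌈B / δ⌉ with hY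
  set Rpt : ℤ × ℤ := x • dir K + Y • dir (K + 1) with hRpt
  set ℓ := ‖γ (c (z + 1)) - P‖ with hℓ
  set s := δ * x - A with hs
  set lam := δ * (R' + 1) with hlam
  have hlam0 : 0 < lam := by rw [hlam]; positivity
  have hs0 : 0 ≤ s := by linarith
  have hsℓ : s ≤ ℓ := by linarith
  -- the foot point
  set q := P + (s : ℂ) * Complex.I ^ e with hq
  have hcz : c z ≤ c (z + 1) := (hcmono (by omega : z < z + 1)).le
  obtain ⟨t₀, ht₀, ht₀q⟩ := exists_mem_Icc_eq_of_norm_le' hγc hcz (hdir z) rfl hs0 hsℓ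
  have hqt₀ : γ t₀ = q := ht₀q
  have hnorm1 : ‖γ t₀ - P‖ = s := by
    rw [hqt₀, hq, add_sub_cancel_left, norm_mul, norm_pow, Complex.norm_I, one_pow, mul_one,
      Complex.norm_real, Real.norm_eq_abs, abs_of_nonneg hs0]
  have hend : γ (c (z + 1)) = P + ((ℓ : ℝ) : ℂ) * Complex.I ^ e :=
    hdir z (c (z + 1)) ⟨hcz, le_rfl⟩
  have hnorm2 : ‖γ (c (z + 1)) - γ t₀‖ = ℓ - s := by
    rw [hqt₀, hq, hend, show P + ((ℓ : ℝ) : ℂ) * Complex.I ^ e - (P + (s : ℂ) * Complex.I ^ e) =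
      ((ℓ - s : ℝ) : ℂ) * Complex.I ^ e by push_cast; ring, norm_mul, norm_pow, Complex.norm_I,
      one_pow, mul_one, Complex.norm_real, Real.norm_eq_abs, abs_of_nonneg (by linarith)]
  have ht₀o : t₀ ∈ Ioo (c z) (c (z + 1)) := by
    refine ⟨lt_of_le_of_ne ht₀.1 fun h => ?_, lt_of_le_of_ne ht₀.2 fun h => ?_⟩
    · have : s = 0 := by rw [← hnorm1, ← h, hP, sub_self, norm_zero]
      linarith
    · have : ℓ - s = 0 := by rw [← hnorm2, h, sub_self, norm_zero]
      linarith
  -- the uniform flat chart at the foot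
  have hfr := tp_frontier_near_edge D hM2 hcmono hcper ha4 hτ hmodτ hdir hmono hκ₀ ht₀
    (lam := lam) hκ (by rw [hnorm1]; linarith) (by rw [hnorm2]; linarith)
  obtain ⟨r₀, hr₀, -, hdom, -⟩ := hflatch z t₀ ht₀o
  obtain ⟨hclos, -⟩ := tp_edge_chart D (D.boundary_mem_frontier t₀) hlam0 hr₀ hfr hdom
  have hqt₀' : D.boundary t₀ = q := hqt₀
  rw [hqt₀'] at hclos
  -- thresholds at the foot
  have hqframe : q * (-Complex.I) ^ e = P * (-Complex.I) ^ e + (s : ℂ) := by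
    rw [hq, add_mul, mul_assoc, I_pow_mul_neg_I_pow, mul_one]
  have hqim : (q * (-Complex.I) ^ e).im = B := by
    rw [hqframe, Complex.add_im, Complex.ofReal_im, add_zero]
  have hqre : (q * (-Complex.I) ^ e).re = δ * x := by
    rw [hqframe, Complex.add_re, Complex.ofReal_re, ← hA, hs]; ring
  have hclosK : ∀ w, dist w q < lam → (w ∈ closure D.carrier ↔
      0 ≤ ((w - q) * (-Complex.I) ^ (K : ℕ)).im) := by rw [hKe]; exact hclos
  -- the mesh point of `R` is within `δ` of the foot
  have hRc := tp_rail_coords K x Y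
  have hmeshR : dist ((Rpt.1 : ℂ) * ((δ : ℝ) : ℂ) + (Rpt.2 : ℂ) * ((δ : ℝ) : ℂ) * Complex.I) q < δ := by
    have hfr' := tp_mesh_frame K δ Rpt
    rw [hRc.1, hRc.2] at hfr'
    have hdiff : ((Rpt.1 : ℂ) * ((δ : ℝ) : ℂ) + (Rpt.2 : ℂ) * ((δ : ℝ) : ℂ) * Complex.I - q) *
        (-Complex.I) ^ (K : ℕ) = (((δ * Y - B : ℝ) : ℂ)) * Complex.I := by
      refine Complex.ext ?_ ?_
      · rw [sub_mul, Complex.sub_re, hfr'.1, hKe, hqre]; simp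
      · rw [sub_mul, Complex.sub_im, hfr'.2, hKe, hqim]; simp
    have hn : ‖((Rpt.1 : ℂ) * ((δ : ℝ) : ℂ) + (Rpt.2 : ℂ) * ((δ : ℝ) : ℂ) * Complex.I - q) *
        (-Complex.I) ^ (K : ℕ)‖ = |δ * Y - B| := by
      rw [hdiff, norm_mul, Complex.norm_I, mul_one, Complex.norm_real, Real.norm_eq_abs]
    rw [norm_mul, norm_pow, norm_neg, Complex.norm_I, one_pow, mul_one] at hn
    rw [dist_eq_norm, hn]
    have hY1 : (Y : ℝ) < B / δ + 1 := Int.ceil_lt_add_one _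
    have hY2 : B / δ ≤ Y := Int.le_ceil _
    rw [abs_of_nonneg (by rw [sub_nonneg, ← div_le_iff₀' hδ]; exact hY2)]
    have := (lt_div_iff₀' hδ).1 (by linarith : (Y : ℝ) - 1 < B / δ)
    linarith
  refine ⟨?_, ?_⟩
  · -- the flatness clause
    refine tp_lattice_flat_rel hδ hV K (by positivity : (0 : ℝ) ≤ R') hclosK Rpt ?_ ?_
    · rw [hRc.2, hKe, hqim]
    · rw [hlam] at *; nlinarith
  · -- walk facts at `R`
    have hK31 : K + 3 + 1 = K := (tp_fin4 K).2.2.1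
    have hmem : ∀ s' t' : ℤ, -2 ≤ s' → s' ≤ 2 → -2 ≤ t' → t' ≤ 2 →
        (Rpt + s' • dir (K + 3 + 1) + t' • dir (K + 3) ∈ V ↔ t' ≤ 0) := by
      intro s' t' hs1 hs2 ht1 ht2
      rw [hK31, tp_dir_add_three]
      rw [smul_neg, ← neg_smul]
      set w := Rpt + s' • dir K + (-t') • dir (K + 1) with hw
      have hlin := tp_dot_lin K Rpt s' (-t')
      have hwc : w.1 * (dir (K + 1)).1 + w.2 * (dir (K + 1)).2 = Y - t' := by
        rw [hw, hlin.2.1, hRc.2]; ring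
      have hwd : dist ((w.1 : ℂ) * ((δ : ℝ) : ℂ) + (w.2 : ℂ) * ((δ : ℝ) : ℂ) * Complex.I) q < lam := by
        have hsq : (((w.1 - Rpt.1) ^ 2 + (w.2 - Rpt.2) ^ 2 : ℤ) : ℝ) ≤ 3 ^ 2 := by
          have hi : (w.1 - Rpt.1) ^ 2 + (w.2 - Rpt.2) ^ 2 ≤ 9 := by
            rw [hw, hlin.2.2]; nlinarith
          exact_mod_cast hi
        have hd := tp_mesh_dist_le hδ.le (by norm_num : (0 : ℝ) ≤ 3) w Rpt hsq
        have := dist_triangle ((w.1 : ℂ) * ((δ : ℝ) : ℂ) + (w.2 : ℂ) * ((δ : ℝ) : ℂ) * Complex.I)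
          ((Rpt.1 : ℂ) * ((δ : ℝ) : ℂ) + (Rpt.2 : ℂ) * ((δ : ℝ) : ℂ) * Complex.I) q
        rw [hlam]
        have hR'3 : (3 : ℝ) ≤ R' := by exact_mod_cast hR'
        nlinarith
      rw [tp_lattice_flat hδ hV K hclosK w hwd, hKe, hqim, hwc]
      omega
    obtain ⟨h1', h2', h3', h4', h5', h6'⟩ := tp_rail_local V (K + 3) Rpt hmem
    rw [hK31] at h5' h6'
    exact ⟨h1', h2', h3', h4', h5', h6'⟩

/-- **Registered sub-goal `s7_dotLin` of stub `stub_transportPaths`** (frame linearity, one-line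
form of `tp_dot_lin`; the rail-point theorem `tp_rail_point` of this file exceeds the
registration cap). [folklore] -/
theorem s7_dotLin : ∀ (K : Fin 4) (C : ℤ × ℤ) (s t : ℤ), ((C + s • dir K + t • Literature.Probability.LatticeModels.CollarLegModel.dir (K + 1)).1 * (dir K).1 + (C + s • dir K + t • Literature.Probability.LatticeModels.CollarLegModel.dir (K + 1)).2 * (dir K).2 = C.1 * (dir K).1 + C.2 * (dir K).2 + s) ∧ ((C + s • dir K + t • Literature.Probability.LatticeModels.CollarLegModel.dir (K + 1)).1 * (Literature.Probability.LatticeModels.CollarLegModel.dir (K + 1)).1 + (C + s • dir K + t • Literature.Probability.LatticeModels.CollarLegModel.dir (K + 1)).2 * (Literature.Probability.LatticeModels.CollarLegModel.dir (K + 1)).2 = C.1 * (Literature.Probability.LatticeModels.CollarLegModel.dir (K + 1)).1 + C.2 * (Literature.Probability.LatticeModels.CollarLegModel.dir (K + 1)).2 + t) ∧ ((C + s • dir K + t • Literature.Probability.LatticeModels.CollarLegModel.dir (K + 1)).1 - C.1) ^ 2 + ((C + s • dir K + t • Literature.Probability.LatticeModels.CollarLegModel.dir (K + 1)).2 - C.2)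 ^ 2 = s ^ 2 + t ^ 2 :=
  fun K C s t => tp_dot_lin K C s t

end Summit.CriticalPhenomena.CardyFormulaZ2.Cruxes.BoundaryDefectGaussianR.RainbowMonomialsInExcursionKernels

end
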